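import Mathlib

/-!
# Approximate greedy atom selection and the incoherence budget of weak OMP (DEQ-A190)

HONEST FRAMING: instance-level adjudication of specific advantage claims; no claim about BQP vs BPP or
the summit.

[folklore] elementary real inequalities, Mathlib only, no `def`, no Literature fact minted.
Context (NOT formalised here): Bellante–Vanerio–Zanero, *Quantum Sparse Recovery and Quantum Orthogonal
Matching Pursuit* (arXiv:2510.06925v1), Cor. 34 / eq. (32): one QOMP iteration returns an atom `j⋆` with
`|⟨d_j, r⟩| - 2 ε_i ≤ |⟨d_{j⋆}, r⟩|` for every atom `j`; Thm 35–40 then run Tropp's weak-OMP analysis with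
weakness `1 - η` once `2 ε_i ≤ η · max_j |⟨d_j, r⟩|`.  DEQ-A190 observes that a CLASSICAL estimator vector
`z` with `|z_j - ⟨d_j, r⟩| ≤ ε_i` for all `j` (length-squared sampling, `Literature…SampleQuery.ipEst`)
gives the same contract by taking `j⋆ = argmax |z_j|`.  This file kernel-checks exactly the deterministic
glue that both the quantum and the classical iteration use:

* `approxArgmax_ge`     — additive-error argmax ⇒ the contract (32);
* `weak_selection`      — contract (32) + `2ε ≤ η |c j|` ⇒ weak-OMP selection `(1-η)|c j| ≤ |c j⋆|`;
* `weakness_ratio`, `erc_budget`, `erc_of_budget`, `half_budget` — the sparsity budget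
  `K < (1-η)/(2-η) · (1 + 1/μ)` of BVZ Thm 40 / eq. (40) is Tropp's `K < α/(1+α) · (1 + 1/μ)` at `α = 1-η`
  (Tropp 2004 Cor. 3.2; Donoho–Elad–Temlyakov 2006 Thm 4.7), it implies `(K-1)μ < 1`,
  `Kμ < α (1 - (K-1)μ)` (the cumulative-coherence form of the weak ERC) and, for `α ≤ 1`, `(K-1)μ < 1/2`;
* `exists_sq_ge_avg`, `sampleCount_scaleFree` — the pigeonhole step of BVZ eq. (41)
  (`‖c‖_∞² ≥ ‖c‖₂²/K` on a `K`-set) and the arithmetic behind DEQ-A190 Thm A190 (B): with the admissible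
  iteration-dependent precision `ε_i(k) = η γ ‖r_k‖ /(2√K)` the length-squared sample count
  `8‖r_k‖²/ε_i(k)²` equals the SCALE-FREE `32 K /(η² γ²)` — the classical iteration pays nothing for the
  final precision `ε`, which is where the amplitude-estimation factor `1/ε_i` of Cor. 34 has no classical
  counterpart to beat;
* `gershgorin_quadratic_form` — for a unit-diagonal Gram table with off-diagonal entries bounded by `μ`,
  `vᵀ G v ≥ (1 - (k-1)μ) ‖v‖²` on any `k`-subset: with the previous item, every sub-Gram matrix on the
  optimal support has smallest eigenvalue `> 1/2` under (40), i.e. the `γ` of Cor. 34 is `> 1/√2` there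
  (DEQ-A190 Cor. A190.3 (i)).
-/

namespace Summit.QuantumAdvantage.Dequantization.ApproximateGreedySelection

open Finset

/-- Additive-error argmax gives the QOMP per-iteration contract (BVZ eq. (32)): if every estimate `z j`
is within `ε` of `c j` on `S` and `j⋆ ∈ S` maximises `|z|` on `S`, then `|c j| - 2ε ≤ |c j⋆|` for all
`j ∈ S`. -/
theorem approxArgmax_ge {ι : Type*} (S : Finset ι) (c z : ι → ℝ) (ε : ℝ)
    (hz : ∀ j ∈ S, |z j - c j| ≤ ε) {jstar : ι} (hmem : jstar ∈ S)
    (hmax : ∀ j ∈ S, |z j| ≤ |z jstar|) : ∀ j ∈ S, |c j| - 2 * ε ≤ |c jstar| := by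
  intro j hj
  have h1 := hz j hj
  have h2 := hz jstar hmem
  have h3 := hmax j hj
  have a1 : |c j| - |z j| ≤ |c j - z j| := abs_sub_abs_le_abs_sub (c j) (z j)
  have a1' : |c j - z j| = |z j - c j| := abs_sub_comm (c j) (z j)
  have a2 : |z jstar| - |c jstar| ≤ |z jstar - c jstar| := abs_sub_abs_le_abs_sub (z jstar) (c jstar)
  linarith

/-- From the additive contract to Tropp's weak greedy selection: `a - 2ε ≤ b` and `2ε ≤ η a` give
`(1 - η) a ≤ b`. -/
theorem weak_of_additive {a b ε η : ℝ} (h : a - 2 * ε ≤ b) (hε : 2 * ε ≤ η * a) :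
    (1 - η) * a ≤ b := by
  nlinarith

/-- Weak-OMP selection from additive estimates: under the hypotheses of `approxArgmax_ge`, for any
`j ∈ S` with `2ε ≤ η |c j|` (in BVZ Thm 38–40: `j` the exact maximiser and `ε_i ≤ η γ ε /(2√K)`),
`(1 - η) |c j| ≤ |c j⋆|`. -/
theorem weak_selection {ι : Type*} (S : Finset ι) (c z : ι → ℝ) (ε η : ℝ)
    (hz : ∀ j ∈ S, |z j - c j| ≤ ε) {jstar : ι} (hmem : jstar ∈ S)
    (hmax : ∀ j ∈ S, |z j| ≤ |z jstar|) {j : ι} (hj : j ∈ S) (hη : 2 * ε ≤ η * |c j|) :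
    (1 - η) * |c j| ≤ |c jstar| :=
  weak_of_additive (approxArgmax_ge S c z ε hz hmem hmax j hj) hη

/-- BVZ's factor `(1-η)/(2-η)` is Tropp's `α/(1+α)` at weakness `α = 1 - η`. -/
theorem weakness_ratio (η : ℝ) : (1 - η) / (2 - η) = (1 - η) / (1 + (1 - η)) := by
  congr 1; ring

/-- The sparsity budget `K < α/(1+α) · (1 + 1/μ)` (BVZ eq. (40) with `α = 1-η`; Tropp 2004 Cor. 3.2)
in cleared-denominator form. -/
theorem erc_budget {K μ α : ℝ} (hμ : 0 < μ) (hα : 0 < α)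
    (hK : K < α / (1 + α) * (1 + 1 / μ)) : K * μ * (1 + α) < α * (1 + μ) := by
  have h1 : 0 < μ * (1 + α) := by positivity
  have hμ' : μ ≠ 0 := ne_of_gt hμ
  have hα' : (1 + α) ≠ 0 := by positivity
  have h2 : α / (1 + α) * (1 + 1 / μ) * (μ * (1 + α)) = α * (1 + μ) := by
    field_simp
    ring
  calc K * μ * (1 + α) = K * (μ * (1 + α)) := by ring
    _ < α / (1 + α) * (1 + 1 / μ) * (μ * (1 + α)) := mul_lt_mul_of_pos_right hK h1
    _ = α * (1 + μ) := h2

/-- Consequences of the budget: `(K-1)μ < 1` and the cumulative-coherence weak-ERC condition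
`Kμ < α (1 - (K-1)μ)`, i.e. `Kμ / (1 - (K-1)μ) < α` (Tropp 2004 Thm 3.5 ⇒ Cor. 3.6 route; BVZ Thm 40,
eq. (42)). -/
theorem erc_of_budget {K μ α : ℝ} (hμ : 0 < μ) (hα : 0 < α)
    (h : K * μ * (1 + α) < α * (1 + μ)) :
    (K - 1) * μ < 1 ∧ K * μ < α * (1 - (K - 1) * μ) := by
  constructor
  · nlinarith
  · nlinarith

/-- Under the budget with weakness `α ≤ 1` (always the case: `α = 1 - η`, `η ∈ [0,1)`), `(K-1)μ < 1/2`;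
with `gershgorin_quadratic_form` this puts the smallest eigenvalue of every Gram sub-table on `≤ K`
incoherent unit atoms above `1/2`. -/
theorem half_budget {K μ α : ℝ} (hμ : 0 < μ) (hα : 0 < α) (hα1 : α ≤ 1)
    (h : K * μ * (1 + α) < α * (1 + μ)) : (K - 1) * μ < 1 / 2 := by
  nlinarith

/-- Gershgorin-type lower bound for the quadratic form of a unit-diagonal table `G` whose off-diagonal
entries on `s` are bounded by `μ ≥ 0` in absolute value:
`(1 - (|s| - 1) μ) Σ_{i∈s} v_i² ≤ Σ_{i∈s} Σ_{j∈s} v_i G_{ij} v_j`. -/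
theorem gershgorin_quadratic_form {ι : Type*} (s : Finset ι) (G : ι → ι → ℝ) (v : ι → ℝ) (μ : ℝ)
    (hμ : 0 ≤ μ) (hdiag : ∀ i ∈ s, G i i = 1)
    (hoff : ∀ i ∈ s, ∀ j ∈ s, i ≠ j → |G i j| ≤ μ) :
    (1 - (s.card - 1) * μ) * ∑ i ∈ s, v i ^ 2 ≤ ∑ i ∈ s, ∑ j ∈ s, v i * G i j * v j := by
  classical
  -- pointwise lower bound for every entry of the double sum
  have hpt : ∀ i ∈ s, ∀ j ∈ s,
      (1 + μ) * (if i = j then v i ^ 2 else 0) - μ * (|v i| * |v j|) ≤ v i * G i j * v j := by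
    intro i hi j hj
    by_cases hij : i = j
    · subst hij
      rw [if_pos rfl, hdiag i hi, abs_mul_abs_self]
      nlinarith
    · rw [if_neg hij, mul_zero, zero_sub]
      have hG := hoff i hi j hj hij
      have h1 : |v i * G i j * v j| ≤ μ * (|v i| * |v j|) := by
        rw [abs_mul, abs_mul]
        have hvi := abs_nonneg (v i)
        have hvj := abs_nonneg (v j)
        calc |v i| * |G i j| * |v j| ≤ |v i| * μ * |v j| := by gcongr
          _ = μ * (|v i| * |v j|) := by ring
      have h2 := neg_abs_le (v i * G i j * v j)
      linarith
  have hsum : ∑ i ∈ s, ∑ j ∈ s, ((1 + μ) * (if i = j then v i ^ 2 else 0) - μ * (|v i| * |v j|))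
      ≤ ∑ i ∈ s, ∑ j ∈ s, v i * G i j * v j := by
    apply Finset.sum_le_sum
    intro i hi
    apply Finset.sum_le_sum
    intro j hj
    exact hpt i hi j hj
  -- evaluate the left double sum
  have hA : ∀ i ∈ s, ∑ j ∈ s, (1 + μ) * (if i = j then v i ^ 2 else 0) = (1 + μ) * v i ^ 2 := by
    intro i hi
    rw [← Finset.mul_sum]
    congr 1
    rw [Finset.sum_ite_eq]
    rw [if_pos hi]
  have hB : ∑ i ∈ s, ∑ j ∈ s, μ * (|v i| * |v j|) = μ * (∑ i ∈ s, |v i|) ^ 2 := by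
    rw [sq, Finset.sum_mul_sum, Finset.mul_sum]
    apply Finset.sum_congr rfl
    intro i hi
    rw [Finset.mul_sum]
  have hL : ∑ i ∈ s, ∑ j ∈ s, ((1 + μ) * (if i = j then v i ^ 2 else 0) - μ * (|v i| * |v j|))
      = (1 + μ) * ∑ i ∈ s, v i ^ 2 - μ * (∑ i ∈ s, |v i|) ^ 2 := by
    have hrow : ∀ i ∈ s, ∑ j ∈ s, ((1 + μ) * (if i = j then v i ^ 2 else 0) - μ * (|v i| * |v j|))
        = (1 + μ) * v i ^ 2 - ∑ j ∈ s, μ * (|v i| * |v j|) := by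
      intro i hi
      rw [Finset.sum_sub_distrib, hA i hi]
    rw [Finset.sum_congr rfl hrow, Finset.sum_sub_distrib, ← Finset.mul_sum, hB]
  -- Cauchy–Schwarz: (Σ |v i|)² ≤ |s| Σ v i²
  have hcs0 := Finset.sum_mul_sq_le_sq_mul_sq s (fun i => |v i|) (fun _ => (1 : ℝ))
  simp only [mul_one, one_pow, sq_abs, Finset.sum_const, nsmul_eq_mul] at hcs0
  have hcs : μ * (∑ i ∈ s, |v i|) ^ 2 ≤ μ * ((s.card : ℝ) * ∑ i ∈ s, v i ^ 2) := by
    apply mul_le_mul_of_nonneg_left _ hμ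
    linarith [hcs0]
  have hv : 0 ≤ ∑ i ∈ s, v i ^ 2 := Finset.sum_nonneg (fun i _ => sq_nonneg (v i))
  nlinarith [hsum, hL, hcs, hv]

/-- DEQ-A190 Cor. A190.3 (i), assembled: under BVZ's budget (40) (cleared form, weakness `α ≤ 1`) every
vector supported on a set `s` of at most `K` unit atoms with pairwise coherence `≤ μ` has
`vᵀ G v ≥ ‖v‖²/2` — the "well-conditioned support" that Cor. 34's `γ` presupposes is implied by the
incoherence hypothesis of Thm 40. -/
theorem wellConditioned_of_budget {ι : Type*} (s : Finset ι) (G : ι → ι → ℝ) (v : ι → ℝ)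
    {K μ α : ℝ} (hμ : 0 < μ) (hα : 0 < α) (hα1 : α ≤ 1)
    (h : K * μ * (1 + α) < α * (1 + μ)) (hcard : (s.card : ℝ) ≤ K)
    (hdiag : ∀ i ∈ s, G i i = 1) (hoff : ∀ i ∈ s, ∀ j ∈ s, i ≠ j → |G i j| ≤ μ) :
    (1 / 2) * ∑ i ∈ s, v i ^ 2 ≤ ∑ i ∈ s, ∑ j ∈ s, v i * G i j * v j := by
  have hg := gershgorin_quadratic_form s G v μ hμ.le hdiag hoff
  have hb := half_budget hμ hα hα1 h
  have hv : 0 ≤ ∑ i ∈ s, v i ^ 2 := Finset.sum_nonneg (fun i _ => sq_nonneg (v i))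
  have hc : (s.card - 1) * μ ≤ (K - 1) * μ := by nlinarith
  nlinarith [hg, hb, hv, hc]

/-- Pigeonhole behind BVZ eq. (41): on a nonempty finite index set some coordinate carries at least the
average square, `Σ_{j∈s} c_j² ≤ |s| · c_i²` (so `‖c‖_∞ ≥ ‖c‖₂ / √|s|`). -/
theorem exists_sq_ge_avg {ι : Type*} (s : Finset ι) (hs : s.Nonempty) (c : ι → ℝ) :
    ∃ i ∈ s, ∑ j ∈ s, c j ^ 2 ≤ s.card * c i ^ 2 := by
  obtain ⟨i, hi, hmax⟩ := Finset.exists_max_image s (fun j => |c j|) hs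
  refine ⟨i, hi, ?_⟩
  have hle : ∀ j ∈ s, c j ^ 2 ≤ c i ^ 2 := by
    intro j hj
    exact sq_le_sq.mpr (hmax j hj)
  calc ∑ j ∈ s, c j ^ 2 ≤ ∑ _j ∈ s, c i ^ 2 := Finset.sum_le_sum hle
    _ = s.card * c i ^ 2 := by simp [Finset.sum_const, nsmul_eq_mul]

/-- The arithmetic of DEQ-A190 Thm A190 (B): with `ε_i = η γ R /(2 t)` (`R = ‖r_k‖ > 0`, `t = √K`), the
length-squared sample count `8 R² / ε_i²` is the scale-free `32 t² /(η² γ²)`. -/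
theorem sampleCount_scaleFree {R η γ t : ℝ} (hR : R ≠ 0) (hη : η ≠ 0) (hγ : γ ≠ 0) (ht : t ≠ 0) :
    8 * R ^ 2 / (η * γ * R / (2 * t)) ^ 2 = 32 * t ^ 2 / (η ^ 2 * γ ^ 2) := by
  field_simp
  ring

end Summit.QuantumAdvantage.Dequantization.ApproximateGreedySelection
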